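import Mathlib
import Summits.ValiantsHypothesis.ValiantsHypothesis.Theses.ElementaryWordLength

/-!
# Sketch — crux-ideate round 2, ideator 4, crux `ElementaryWordLength.WordPerSuperQuartic` (stmt-ValiantsHypothesis-6624)

First lemmas of the two idea cards filed by this seat:

* card `crossing-windows`: `window_lemma`, `per_crossing` (statements), `hessian_staircase` (statement);
* card `three-read-dichotomy`: `three_read_pencil`, `three_read_word` (KERNEL-CHECKED identities over any
  commutative ring), `pencil_dichotomy_three` (statement).

Word model = the route's inline predicate: a word is a `List (Fin 3 × Fin 3 × ℂ × Option σ)`, letter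
`(i, j, λ, v) ↦ Matrix.transvection i j (C λ * (v.elim 1 X))`, computing `Matrix.transvection 0 2 F`.
-/

set_option linter.unusedVariables false
set_option linter.dupNamespace false

namespace Summit.ValiantsHypothesis.ValiantsHypothesis.Cruxes.WordPerSuperQuartic.Ideator4

open MvPolynomial Matrix
open scoped Classical

noncomputable section

variable {σ : Type}

/-- letter matrix — verbatim the route's inline term -/
abbrev letter (l : Fin 3 × Fin 3 × ℂ × Option σ) : Matrix (Fin 3) (Fin 3) (MvPolynomial σ ℂ) :=
  Matrix.transvection l.1 l.2.1 (MvPolynomial.C l.2.2.1 * l.2.2.2.elim 1 MvPolynomial.X)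

/-- product of a word — verbatim the route's inline term -/
abbrev wordProd (w : List (Fin 3 × Fin 3 × ℂ × Option σ)) : Matrix (Fin 3) (Fin 3) (MvPolynomial σ ℂ) :=
  (w.map letter).prod

theorem wordProd_eq_inline (w : List (Fin 3 × Fin 3 × ℂ × Option σ)) :
    wordProd w = (w.map (fun l => Matrix.transvection l.1 l.2.1
      (MvPolynomial.C l.2.2.1 * l.2.2.2.elim 1 MvPolynomial.X))).prod := rfl

/-- the `t`-th letter of `w` reads the variable `y` -/
def ReadsAt (w : List (Fin 3 × Fin 3 × ℂ × Option σ)) (t : ℕ) (y : σ) : Prop :=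
  ∃ h : t < w.length, (w.get ⟨t, h⟩).2.2.2 = some y

/-! ## Card `crossing-windows` -/

/-- **Window lemma** (exact, all multiplicities; proof = factorisation `A(z,r)·M(y,r)·B(z,r)`, two
specialisations, and `units of ℂ[x] are constants` applied to the unimodular column `C e₀` of
`C := A(z,r)A(0,r)⁻¹`).  If every read of `y` lies in a time window `[t₁, t₂]` that contains no read of
`z`, then NO monomial of the computed polynomial contains both `y` and `z`. -/
theorem window_lemma [DecidableEq σ] (w : List (Fin 3 × Fin 3 × ℂ × Option σ))
    (F : MvPolynomial σ ℂ) (hw : ∀ l ∈ w, l.1 ≠ l.2.1)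
    (hW : wordProd w = Matrix.transvection (0 : Fin 3) 2 F)
    (y z : σ) (hyz : y ≠ z) (t₁ t₂ : ℕ)
    (hy : ∀ t, ReadsAt w t y → t₁ ≤ t ∧ t ≤ t₂)
    (hz : ∀ t, t₁ ≤ t → t ≤ t₂ → ¬ ReadsAt w t z) :
    ∀ m : σ →₀ ℕ, m y ≠ 0 → m z ≠ 0 → MvPolynomial.coeff m F = 0 := by
  sorry

/-- **Crossing corollary for the permanent.**  In every word for `E₀₂(per_n)`, for every NON-ATTACKING
pair of positions `y, z` (different rows and different columns) some read of `z` lies strictly between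
two reads of `y` (and symmetrically): the `{y,z}`-subsequence of reads contains the pattern `y z y z`
or `z y z y`.  Two reads (`chain_read_once`, p112552) is the special case "a once-read `y` has an empty
open span". -/
theorem per_crossing (n : ℕ) (w : List (Fin 3 × Fin 3 × ℂ × Option (Fin n × Fin n)))
    (hw : ∀ l ∈ w, l.1 ≠ l.2.1)
    (hW : wordProd w = Matrix.transvection (0 : Fin 3) 2
      (Literature.Computability.AlgebraicComplexity.perPoly (Fin n) ℂ))
    (y z : Fin n × Fin n) (hrow : y.1 ≠ z.1) (hcol : y.2 ≠ z.2) :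
    ∃ t t₁ t₂ : ℕ, ReadsAt w t₁ y ∧ ReadsAt w t₂ y ∧ t₁ < t ∧ t < t₂ ∧ ReadsAt w t z := by
  sorry

/-- **Hessian staircase identity** (second-order costate).  For a word computing `E₀₂(F)` there are
polynomial 3-vectors `a t` (= column `i_t` of the prefix before letter `t`), `b s` (= row `j_s` of the
inverse of the prefix through letter `s`) and scalars `α s, β t` such that for all `u ≠ v`
`∂_u∂_v F = Σ_{s<t, {v_s,v_t}={u,v}} α s · ⟨b s, a t⟩ · β t`.  Hence the full matrix `(⟨b s, a t⟩)_{s,t}`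
has rank ≤ 3 over `ℂ(x)` and the mixed Hessian block `H[U,V]` of `F` is a read-aggregated STAIRCASE
truncation of it: `rank_{ℂ(x)} H[U,V] ≤ 3·(alt(U,V)+1)` (card `crossing-windows`, lemma H). -/
theorem hessian_staircase [DecidableEq σ] (w : List (Fin 3 × Fin 3 × ℂ × Option σ))
    (F : MvPolynomial σ ℂ) (hw : ∀ l ∈ w, l.1 ≠ l.2.1)
    (hW : wordProd w = Matrix.transvection (0 : Fin 3) 2 F) :
    ∃ (a b : ℕ → Fin 3 → MvPolynomial σ ℂ) (α β : ℕ → MvPolynomial σ ℂ),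
      ∀ u v : σ, u ≠ v →
        MvPolynomial.pderiv u (MvPolynomial.pderiv v F) =
          ∑ s ∈ Finset.range w.length, ∑ t ∈ Finset.range w.length,
            if s < t ∧ ((ReadsAt w s u ∧ ReadsAt w t v) ∨ (ReadsAt w s v ∧ ReadsAt w t u)) then
              α s * (∑ i : Fin 3, b s i * a t i) * β t else 0 := by
  sorry

/-! ## Card `three-read-dichotomy` -/

section pencil
variable {R : Type*} [CommRing R]

/-- rank-one square-zero 3×3 matrix `a bᵀ` -/
def outer (a b : Fin 3 → R) : Matrix (Fin 3) (Fin 3) R := Matrix.of fun i j => a i * b j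

/-- **The non-commuting three-read pencil** (type N): with `a₁ = a₂ = e₁`, `b₁ = (p,0,q)`,
`b₂ = (-p,0,1-q)`, `a₃ = (g,-1,0)`, `b₃ = e₂` — all unimodular when `p = 1` — one has
`(1 + t a₁b₁ᵀ)(1 + t a₂b₂ᵀ)(1 + t a₃b₃ᵀ) = E₀₂(t·g)` for EVERY `g`: three reads of one variable
realise an ARBITRARY derivative `g` at the pencil level, with `[N₁,N₃] = p g·e₁₂ ≠ 0` (so this is not
the commuting / common-point-or-line type of the two-read arc lemma).  Kernel-checked. -/
theorem three_read_pencil (t g p q : R) :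
    (1 + t • outer ![0, 1, 0] ![p, 0, q]) * (1 + t • outer ![0, 1, 0] ![-p, 0, 1 - q]) *
        (1 + t • outer ![g, -1, 0] ![0, 0, 1])
      = Matrix.transvection (0 : Fin 3) 2 (t * g) := by
  ext i j
  fin_cases i <;> fin_cases j <;>
    simp [outer, Matrix.transvection, Matrix.mul_apply, Fin.sum_univ_three, Matrix.one_apply,
      Matrix.single, Matrix.add_apply] <;> ring

/-- **A word realising it**: `E₁₀(y)·E₀₂(1)·E₁₀(-y)·E₀₁(g)·E₁₂(-y)·E₀₁(-g)·E₀₂(-1) = E₀₂(-g·y)` — `y` read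
three times, the costate pencil of `y` is (a conjugate of) the type-N pencil above, and the prefix before
the third read has CLEAN-computed `g` as a matrix entry (the column `(g,-1,0)ᵀ` up to constants).
Kernel-checked over any commutative ring (`g` a free symbol standing for a sub-word's value). -/
theorem three_read_word (y g : R) :
    Matrix.transvection (1 : Fin 3) 0 y * Matrix.transvection (0 : Fin 3) 2 1 *
      Matrix.transvection (1 : Fin 3) 0 (-y) * Matrix.transvection (0 : Fin 3) 1 g *
      Matrix.transvection (1 : Fin 3) 2 (-y) * Matrix.transvection (0 : Fin 3) 1 (-g) *
      Matrix.transvection (0 : Fin 3) 2 (-1)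
      = Matrix.transvection (0 : Fin 3) 2 (-(g * y)) := by
  ext i j
  fin_cases i <;> fin_cases j <;>
    simp [Matrix.transvection, Matrix.mul_apply, Fin.sum_univ_three, Matrix.one_apply,
      Matrix.single, Matrix.add_apply]

end pencil

/-- `v` is a unimodular vector over the polynomial ring (some linear combination of its entries is 1). -/
def Unimodular (v : Fin 3 → MvPolynomial σ ℂ) : Prop := ∃ c : Fin 3 → MvPolynomial σ ℂ, ∑ i, c i * v i = 1

/-- **Three-read pencil dichotomy** (the `r = 3` arc lemma, statement).  Three unimodular flags
`(aₖ, bₖ)` over `ℂ[x]` whose common-parameter product `Π (1 + t aₖbₖᵀ)` is the transvection pencil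
`E₀₂(t·g)` (as happens for the costate letters of a variable read exactly three times, by read
localisation T3') are of COMMUTING type (all three points equal up to units, or all three lines equal up
to units — then the two arcs perform a nested, Horner-form twisted computation of `g`) or of type N
(up to the left/right dual): two points coincide up to a unit and `g·e₀` is a CONSTANT combination
`β (h·a + a₃)` of the common point and the third point — a prefix has clean-computed `g` up to the
content correction `h·a`.  Proof route: `t³`-coefficient ⇒ `(b₁·a₂)(b₂·a₃) = 0`; branch; two uses of the
two-read arc lemma (`arc_lemma`, CostateToolbox T2) with one NON-unimodular summand, whose content `h`
is the only new phenomenon at `r = 3`. -/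
theorem pencil_dichotomy_three (a₁ a₂ a₃ b₁ b₂ b₃ : Fin 3 → MvPolynomial σ ℂ) (g : MvPolynomial σ ℂ)
    (hg : g ≠ 0)
    (ua₁ : Unimodular a₁) (ua₂ : Unimodular a₂) (ua₃ : Unimodular a₃)
    (ub₁ : Unimodular b₁) (ub₂ : Unimodular b₂) (ub₃ : Unimodular b₃)
    (h₁ : ∑ i, b₁ i * a₁ i = 0) (h₂ : ∑ i, b₂ i * a₂ i = 0) (h₃ : ∑ i, b₃ i * a₃ i = 0)
    (hpencil : ∀ t : MvPolynomial σ ℂ,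
      (1 + t • outer a₁ b₁) * (1 + t • outer a₂ b₂) * (1 + t • outer a₃ b₃)
        = Matrix.transvection (0 : Fin 3) 2 (t * g)) :
    -- type C (common point): all points are unit multiples of one another
    (∃ θ₂ θ₃ : ℂ, θ₂ ≠ 0 ∧ θ₃ ≠ 0 ∧ a₂ = θ₂ • a₁ ∧ a₃ = θ₃ • a₁) ∨
    -- type C' (common line)
    (∃ θ₂ θ₃ : ℂ, θ₂ ≠ 0 ∧ θ₃ ≠ 0 ∧ b₂ = θ₂ • b₁ ∧ b₃ = θ₃ • b₁) ∨
    -- type N: two points coincide and g·e₀ is a constant combination of that point and the third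
    (∃ (θ β : ℂ) (h : MvPolynomial σ ℂ), θ ≠ 0 ∧ β ≠ 0 ∧
        ((a₂ = θ • a₁ ∧ (fun i => if i = 0 then g else 0) = β • (h • a₁ + a₃)) ∨
         (a₃ = θ • a₁ ∧ (fun i => if i = 0 then g else 0) = β • (h • a₁ + a₂)) ∨
         (a₃ = θ • a₂ ∧ (fun i => if i = 0 then g else 0) = β • (h • a₂ + a₁)))) ∨
    -- type N' (dual): two lines coincide and g·e₂ᵀ is a constant combination of that line and the third
    (∃ (θ β : ℂ) (h : MvPolynomial σ ℂ), θ ≠ 0 ∧ β ≠ 0 ∧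
        ((b₂ = θ • b₁ ∧ (fun i => if i = 2 then g else 0) = β • (h • b₁ + b₃)) ∨
         (b₃ = θ • b₁ ∧ (fun i => if i = 2 then g else 0) = β • (h • b₁ + b₂)) ∨
         (b₃ = θ • b₂ ∧ (fun i => if i = 2 then g else 0) = β • (h • b₂ + b₁)))) := by
  sorry

end

end Summit.ValiantsHypothesis.ValiantsHypothesis.Cruxes.WordPerSuperQuartic.Ideator4
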